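import Summits.Ventures.Crystal3D.Bulk.RotSysRegions
import HarnessLib

/-!
# Faces of a connected sub-map of a planar map ↔ its regions (generic brick, part 2 of
# `Bulk/RotSysRegions.lean`; `phase2/LEAN-FACES-DESIGN.md` (F2)(i)/(F3))

HONEST FRAMING. Part of the venture `Summits/Ventures/Crystal3D` (cell `pub-crystal3d`, phase 2;
seat typer-bulk-2), generic and geometry-free (namespace `RotSys`); nothing here mentions GAP(1.26).
For a loopless rotation system `(σ, α)` on a finite dart type whose full map is PLANAR and
CONNECTED (`chi2 σ α univ = 4`, `numK σ α univ = 1`) and an `α`-closed CONNECTED `S`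
(`numK σ α S = 1`): **`IsRotSys.regions_main`** — (i) every dart is region-related
(`regRel σ α S`) to a dart of `S`, (ii) two darts of `S` are region-related iff they lie on the
same face of `S` (`(phi σ α S).SameCycle`); by induction on the number of darts outside `S`
(grow `S` by an ambient edge at one of its vertices, `exists_sameCycle_not_mem`,
`numK_insert_pair_eq_one`; deleting it back is a MERGE — `sameCycle_swap_mul_iff_merge` +
`regRel_sdiff_iff` —, or PENDANT — `phi_sdiff_eq_induce_of_pendant` —, the non-pendant SPLIT being
excluded by planarity `chi2_eq_of_subset`). Restated: **`exists_mem_regRel`**,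
**`regRel_iff_sameCycle_phi`** (faces ↔ regions bijectively: «every face of a connected plane
map is a disc with one boundary walk»), **`numClasses_regRel_eq_numF`** (`#regions = numF`).
-/

namespace Summit.Ventures.Crystal3D

namespace RotSys

open Equiv Equiv.Perm Finset

variable {D : Type*} [DecidableEq D] [Fintype D]
variable {σ α : Perm D} {S : Finset D}

/-! ## Class-count helpers -/

section Classes

open scoped Classical

omit [Fintype D] in
/-- One class only: all points are related (for `R` reflexive on `S`). -/
theorem rel_of_numClasses_eq_one {R : D → D → Prop} {S : Finset D} (h1 : numClasses R S = 1)
    (hrefl : ∀ x ∈ S, R x x) {x y : D} (hx : x ∈ S) (hy : y ∈ S) : R x y := by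
  unfold numClasses at h1
  obtain ⟨a, ha⟩ := Finset.card_eq_one.1 h1
  have hcls : ∀ z ∈ S, (S.filter fun w => R z w) = a := fun z hz => by
    have hm := mem_image_of_mem (fun z => S.filter fun w => R z w) hz
    rw [ha, mem_singleton] at hm
    exact hm
  have hyy : y ∈ S.filter fun w => R y w := mem_filter.2 ⟨hy, hrefl y hy⟩
  rw [hcls y hy, ← hcls x hx, mem_filter] at hyy
  exact hyy.2

omit [Fintype D] in
/-- All points related on a nonempty set: exactly one class. -/
theorem numClasses_eq_one_of_forall {R : D → D → Prop} {S : Finset D} (hne : S.Nonempty)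
    (hall : ∀ x ∈ S, ∀ y ∈ S, R x y) : numClasses R S = 1 := by
  unfold numClasses
  rw [Finset.card_eq_one]
  refine ⟨S, ?_⟩
  ext A
  rw [mem_image, mem_singleton]
  constructor
  · rintro ⟨x, hx, rfl⟩
    exact filter_true_of_mem fun y hy => hall x hx y hy
  · rintro rfl
    obtain ⟨x, hx⟩ := hne
    exact ⟨x, hx, filter_true_of_mem fun y hy => hall x hx y hy⟩

omit [DecidableEq D] [Fintype D] in
/-- Two functions with the same kernel on `S` have images of the same size. -/
theorem card_image_eq_of_ker_iff {β γ : Type*} [DecidableEq β] [DecidableEq γ] (S : Finset D)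
    (f : D → β) (g : D → γ) (hfg : ∀ x ∈ S, ∀ y ∈ S, f x = f y ↔ g x = g y) :
    (S.image f).card = (S.image g).card := by
  refine Finset.card_bij (fun b hb => g (Classical.choose (mem_image.1 hb))) ?_ ?_ ?_
  · intro b hb
    exact mem_image_of_mem g (Classical.choose_spec (mem_image.1 hb)).1
  · intro b₁ hb₁ b₂ hb₂ heq
    obtain ⟨h₁S, h₁⟩ := Classical.choose_spec (mem_image.1 hb₁)
    obtain ⟨h₂S, h₂⟩ := Classical.choose_spec (mem_image.1 hb₂)
    rw [← h₁, ← h₂]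
    exact (hfg _ h₁S _ h₂S).2 heq
  · intro c hc
    obtain ⟨x, hx, rfl⟩ := mem_image.1 hc
    refine ⟨f x, mem_image_of_mem f hx, ?_⟩
    obtain ⟨hS', h'⟩ := Classical.choose_spec (mem_image.1 (mem_image_of_mem f hx))
    exact (hfg _ hS' _ hx).1 h'

end Classes

/-! ## Growing a connected sub-map by one ambient edge -/

omit [DecidableEq D] in
/-- In a connected ambient map, a proper nonempty `α`-closed dart subset has an ambient dart
OUTSIDE it at one of its vertices. -/
theorem exists_sameCycle_not_mem [DecidableEq D] (hK : numK σ α (univ : Finset D) = 1)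
    (h : IsRotSys σ α) (hS : IsClosed α S) (hne : S.Nonempty) (hSu : S ≠ univ) :
    ∃ d, d ∉ S ∧ ∃ x ∈ S, σ.SameCycle x d := by
  by_contra hcon
  push Not at hcon
  have closed : ∀ x z, conn σ α univ x z → (x ∈ S ↔ z ∈ S) := by
    intro x z hxz
    induction hxz with
    | rel a b hab =>
      obtain ⟨-, -, hab⟩ := hab
      rcases hab with hc | rfl
      · constructor
        · intro ha
          by_contra hb
          exact hcon b hb a ha hc
        · intro hb
          by_contra ha
          exact hcon a ha b hb hc.symm
      · constructor
        · exact hS a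
        · intro hb
          have := hS _ hb
          rwa [h.α_inv] at this
    | refl a => exact Iff.rfl
    | symm a b _ ih => exact ih.symm
    | trans a b c _ _ ih1 ih2 => exact ih1.trans ih2
  obtain ⟨x₀, hx₀⟩ := hne
  apply hSu
  ext z
  simp only [mem_univ, iff_true]
  exact (closed x₀ z (rel_of_numClasses_eq_one hK (fun x _ => conn_refl σ α _ x) (mem_univ _)
    (mem_univ _))).1 hx₀

omit [Fintype D] in
/-- Adding the two darts of an ambient edge at a vertex of a connected `S` keeps it connected. -/
theorem numK_insert_pair_eq_one (h : IsRotSys σ α) (hKS : numK σ α S = 1) {x₀ d : D}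
    (hx₀ : x₀ ∈ S) (hc : σ.SameCycle x₀ d) :
    numK σ α (insert d (insert (α d) S)) = 1 := by
  set S' := insert d (insert (α d) S) with hS'
  have hsub : S ⊆ S' := fun x hx => mem_insert_of_mem (mem_insert_of_mem hx)
  have hdS' : d ∈ S' := mem_insert_self _ _
  have hαS' : α d ∈ S' := mem_insert_of_mem (mem_insert_self _ _)
  have to_x₀ : ∀ u ∈ S', conn σ α S' u x₀ := by
    intro u hu
    rw [hS', mem_insert, mem_insert] at hu
    rcases hu with rfl | rfl | hu
    · exact conn_symm (conn_of_sameCycle (hsub hx₀) hdS' hc)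
    · refine conn_trans ?_ (conn_symm (conn_of_sameCycle (hsub hx₀) hdS' hc))
      exact Relation.EqvGen.rel _ _ ⟨hαS', hdS', Or.inr (h.α_inv d).symm⟩
    · exact conn_mono hsub (rel_of_numClasses_eq_one hKS (fun x _ => conn_refl σ α S x) hu hx₀)
  exact numClasses_eq_one_of_forall ⟨d, hdS'⟩ fun u hu v hv =>
    conn_trans (to_x₀ u hu) (conn_symm (to_x₀ v hv))

/-! ## The pendant splice -/

/-- **Pendant deletion does not change the faces as a partition**: if `φ_S d = α d` (the dart
`α d` is alone at its vertex) while `d` is not alone at its vertex, then on `S \ {d, α d}` the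
face permutation of `S \ {d, α d}` is the first-return map of `φ_S`. -/
theorem IsRotSys.phi_sdiff_eq_induce_of_pendant (h : IsRotSys σ α) (hS : IsClosed α S) {d : D}
    (hd : d ∈ S) (ha : phi σ α S d = α d) (hb : phi σ α S (α d) ≠ d) {x : D}
    (hx : x ∈ S \ {d, α d}) :
    phi σ α (S \ {d, α d}) x = induce (phi σ α S) (S \ {d, α d}) x := by
  have hxS : x ∈ S := (mem_sdiff.1 hx).1
  have mem_S' : ∀ z, z ∈ S \ {d, α d} ↔ z ∈ S ∧ z ≠ d ∧ z ≠ α d := by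
    intro z
    rw [mem_sdiff, mem_insert, mem_singleton, not_or]
  rw [h.phi_sdiff_apply hS hd hx]
  split_ifs with h1 h2
  · -- `φ x = d`: the walk `x → d → α d → φ (α d)` first returns at `φ (α d)`
    symm
    have hw : phi σ α S (α d) ∈ S \ {d, α d} := by
      rw [mem_S']
      exact ⟨phi_apply_mem hS (hS d hd), hb, h.phi_ne_self S (α d)⟩
    refine induce_eq_of_first_return _ hx (n := 3) (by norm_num) ?_ hw ?_
    · rw [show (3 : ℕ) = 1 + 1 + 1 from rfl, pow_succ, pow_succ, pow_one, Perm.mul_apply,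
        Perm.mul_apply, h1, ha]
    · intro m hm0 hm3
      obtain rfl | rfl : m = 1 ∨ m = 2 := by omega
      · rw [pow_one, h1, mem_S']; tauto
      · rw [pow_succ, pow_one, Perm.mul_apply, h1, ha, mem_S']; tauto
  · -- `φ x = α d = φ d` forces `x = d ∉ S \ e`
    exfalso
    have : x = d := (phi σ α S).injective (h2.trans ha.symm)
    rw [this, mem_S'] at hx
    exact hx.2.1 rfl
  · symm
    exact induce_eq_of_first_return _ hx Nat.one_pos (by rw [pow_one])
      ((mem_S' _).2 ⟨phi_apply_mem hS hxS, h1, h2⟩) (fun m hm0 hm1 => absurd hm1 (by omega))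

/-- Hence in the pendant case the faces of `S \ {d, α d}` are the traces of the faces of `S`. -/
theorem IsRotSys.sameCycle_phi_sdiff_iff_of_pendant (h : IsRotSys σ α) (hS : IsClosed α S)
    {d : D} (hd : d ∈ S) (ha : phi σ α S d = α d) (hb : phi σ α S (α d) ≠ d) {x y : D}
    (hx : x ∈ S \ {d, α d}) (hy : y ∈ S \ {d, α d}) :
    (phi σ α (S \ {d, α d})).SameCycle x y ↔ (phi σ α S).SameCycle x y := by
  have hS' : IsClosed α (S \ {d, α d}) := isClosed_sdiff_pair h hS d
  rw [sameCycle_iff_of_eqOn (fun z hz => h.phi_sdiff_eq_induce_of_pendant hS hd ha hb hz)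
    (fun z hz => phi_apply_mem hS' hz) (fun z hz => induce_apply_mem _ hz) hx y]
  exact sameCycle_induce_iff _ hx hy

/-- In the MERGE case the faces of `S \ {d, α d}` are read off `ν = swap d (α d) * φ_S`. -/
theorem IsRotSys.sameCycle_phi_sdiff_iff_nu (h : IsRotSys σ α) (hS : IsClosed α S) {d : D}
    (hd : d ∈ S) {x y : D} (hx : x ∈ S \ {d, α d}) (hy : y ∈ S \ {d, α d}) :
    (phi σ α (S \ {d, α d})).SameCycle x y ↔ (nu σ α S d).SameCycle x y := by
  have hS' : IsClosed α (S \ {d, α d}) := isClosed_sdiff_pair h hS d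
  rw [sameCycle_iff_of_eqOn (fun z hz => h.phi_sdiff_eq_induce_nu hS hd hz)
    (fun z hz => phi_apply_mem hS' hz) (fun z hz => induce_apply_mem _ hz) hx y]
  exact sameCycle_induce_iff _ hx hy

/-! ## The theorem -/

/-- **Faces ↔ regions for connected sub-maps of a planar connected map** (both halves, by
induction on the number of darts outside `S`). -/
theorem IsRotSys.regions_main (h : IsRotSys σ α) (hplanar : chi2 σ α (univ : Finset D) = 4)
    (hK : numK σ α (univ : Finset D) = 1) :
    ∀ (n : ℕ) (S : Finset D), (univ \ S).card = n → IsClosed α S → numK σ α S = 1 →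
      (∀ z, ∃ x ∈ S, regRel σ α S z x) ∧
        (∀ x ∈ S, ∀ y ∈ S, regRel σ α S x y → (phi σ α S).SameCycle x y) := by
  intro n
  induction n using Nat.strong_induction_on with
  | _ n ih =>
  intro S hn hS hKS
  have hplanar' : chi2 σ α (univ : Finset D) = 4 * (numK σ α (univ : Finset D) : ℤ) := by
    rw [hplanar, hK]; norm_num
  have hcl_univ : IsClosed α (univ : Finset D) := fun x _ => mem_univ _
  by_cases hSu : S = univ
  · -- the full map: regions = faces
    subst hSu
    refine ⟨fun z => ⟨z, mem_univ z, regRel_refl σ α _ z⟩, fun x _ y _ hxy => ?_⟩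
    rw [phi_univ]
    exact (regRel_univ_iff x y).1 hxy
  -- grow `S` by an ambient edge `{d, α d}` at one of its vertices
  have hne : S.Nonempty := by
    rw [Finset.nonempty_iff_ne_empty]; rintro rfl; rw [numK_empty] at hKS; exact zero_ne_one hKS
  obtain ⟨d, hdS, x₀, hx₀, hc⟩ := exists_sameCycle_not_mem hK h hS hne hSu
  have hαdS : α d ∉ S := fun hmem => hdS (by have := hS _ hmem; rwa [h.α_inv] at this)
  set T := insert d (insert (α d) S) with hT
  have hdT : d ∈ T := mem_insert_self _ _
  have hST : S ⊆ T := fun x hx => mem_insert_of_mem (mem_insert_of_mem hx)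
  have hTcl : IsClosed α T := by
    intro x hx
    rw [hT, mem_insert, mem_insert] at hx ⊢
    rcases hx with rfl | rfl | hx
    · exact Or.inr (Or.inl rfl)
    · exact Or.inl (h.α_inv d)
    · exact Or.inr (Or.inr (hS x hx))
  have hTS : T \ {d, α d} = S := by
    ext z
    simp only [hT, mem_sdiff, mem_insert, mem_singleton, not_or]
    constructor
    · rintro ⟨h1 | h1 | h1, h2, h3⟩
      · exact absurd h1 h2
      · exact absurd h1 h3
      · exact h1
    · intro hz
      exact ⟨Or.inr (Or.inr hz), fun e => hdS (e ▸ hz), fun e => hαdS (e ▸ hz)⟩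
  have hKT : numK σ α T = 1 := numK_insert_pair_eq_one h hKS hx₀ hc
  have hlt : (univ \ T).card < n := by
    rw [← hn]
    apply card_lt_card
    refine ⟨sdiff_subset_sdiff subset_rfl hST, fun hsub => ?_⟩
    have := hsub (mem_sdiff.2 ⟨mem_univ d, hdS⟩)
    exact (mem_sdiff.1 this).2 hdT
  obtain ⟨IH1, IH2⟩ := ih _ hlt T rfl hTcl hKT
  have hx₀T : x₀ ∈ T := hST hx₀
  have hb : phi σ α T (α d) ≠ d := by
    rw [phi_apply, h.α_inv]
    exact induce_ne_self_of_mem_cycle σ hdT hx₀T (fun e => hdS (e ▸ hx₀)) hc.symm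
  have memS : ∀ z, z ∈ S ↔ z ∈ T ∧ z ≠ d ∧ z ≠ α d := by
    intro z
    constructor
    · intro hz
      exact ⟨hST hz, fun e => hdS (e ▸ hz), fun e => hαdS (e ▸ hz)⟩
    · rintro ⟨hzT, h1, h2⟩
      rw [hT, mem_insert, mem_insert] at hzT
      rcases hzT with e | e | hz
      · exact absurd e h1
      · exact absurd e h2
      · exact hz
  have phiT_mem_S : ∀ z ∈ T, phi σ α T z ≠ d → phi σ α T z ≠ α d → phi σ α T z ∈ S :=
    fun z hz h1 h2 => (memS _).2 ⟨phi_apply_mem hTcl hz, h1, h2⟩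
  by_cases hsplit : (phi σ α T).SameCycle d (α d)
  · by_cases ha : phi σ α T d = α d
    · -- PENDANT: `α d` alone at its vertex
      have hw : phi σ α T (α d) ∈ S := phiT_mem_S _ (hTcl d hdT) hb (h.phi_ne_self T _)
      have hdw : regRel σ α T d (phi σ α T (α d)) :=
        regRel_trans (ha ▸ regRel_phi h hTcl d) (regRel_phi h hTcl (α d))
      -- the new gluing `d ~ α d` is already a `T`-relation
      have hdα : regRel σ α T d (α d) := ha ▸ regRel_phi h hTcl d
      have lift : ∀ x y, regRel σ α S x y → regRel σ α T x y := by
        intro x y hxy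
        rw [← hTS] at hxy
        rcases (regRel_sdiff_iff h d x y).1 hxy with h1 | ⟨h2, h3⟩ | ⟨h2, h3⟩
        · exact h1
        · exact regRel_trans h2 (regRel_trans hdα h3)
        · exact regRel_trans h2 (regRel_trans (regRel_symm hdα) h3)
      refine ⟨fun z => ?_, fun x hx y hy hxy => ?_⟩
      · obtain ⟨x, hxT, hzx⟩ := IH1 z
        rw [hT, mem_insert, mem_insert] at hxT
        rcases hxT with rfl | rfl | hxS
        · exact ⟨_, hw, regRel_mono hST (regRel_trans hzx hdw)⟩
        · exact ⟨_, hw, regRel_mono hST (regRel_trans hzx (regRel_phi h hTcl _))⟩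
        · exact ⟨x, hxS, regRel_mono hST hzx⟩
      · have hxy' := IH2 x (hST hx) y (hST hy) (lift x y hxy)
        rw [← hTS] at hx hy ⊢
        exact (h.sameCycle_phi_sdiff_iff_of_pendant hTcl hdT ha hb hx hy).2 hxy'
    · -- genuine SPLIT: would disconnect `S` — excluded by planarity
      exfalso
      have hV := h.numV_sdiff hTcl hdT
      have hE := h.card_sdiff hTcl hdT
      have hF := h.numF_sdiff_split hTcl hdT hsplit
      rw [if_neg ha, if_neg hb, hTS] at hV hF
      rw [hTS] at hE
      have hpS := h.chi2_eq_of_subset hcl_univ hS (subset_univ _) hplanar'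
      have hpT := h.chi2_eq_of_subset hcl_univ hTcl (subset_univ _) hplanar'
      rw [hKS] at hpS
      rw [hKT] at hpT
      unfold chi2 at hpS hpT
      omega
  · -- MERGE
    have ha : phi σ α T d ≠ α d := fun he => hsplit ⟨1, by simp [he]⟩
    have hdS' : phi σ α T d ∈ S := phiT_mem_S _ hdT (h.phi_ne_self T _) ha
    have hαS' : phi σ α T (α d) ∈ S := phiT_mem_S _ (hTcl d hdT) hb (h.phi_ne_self T _)
    refine ⟨fun z => ?_, fun x hx y hy hxy => ?_⟩
    · obtain ⟨x, hxT, hzx⟩ := IH1 z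
      rw [hT, mem_insert, mem_insert] at hxT
      rcases hxT with rfl | rfl | hxS
      · exact ⟨_, hdS', regRel_mono hST (regRel_trans hzx (regRel_phi h hTcl _))⟩
      · exact ⟨_, hαS', regRel_mono hST (regRel_trans hzx (regRel_phi h hTcl _))⟩
      · exact ⟨x, hxS, regRel_mono hST hzx⟩
    · have hxT := hST hx
      have hyT := hST hy
      rw [← hTS] at hx hy hxy ⊢
      rw [h.sameCycle_phi_sdiff_iff_nu hTcl hdT hx hy, nu,
        sameCycle_swap_mul_iff_merge (phi σ α T) hsplit x y]
      rcases (regRel_sdiff_iff h d x y).1 hxy with h1 | ⟨h2, h3⟩ | ⟨h2, h3⟩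
      · exact Or.inl (IH2 x hxT y hyT h1)
      · exact Or.inr ⟨Or.inl (IH2 x hxT d hdT h2).symm, Or.inr (IH2 _ (hTcl d hdT) y hyT h3)⟩
      · exact Or.inr ⟨Or.inr (IH2 x hxT _ (hTcl d hdT) h2).symm, Or.inl (IH2 d hdT y hyT h3)⟩

/-- **Every region of a connected sub-map contains one of its darts** (faces → regions is
onto). -/
theorem IsRotSys.exists_mem_regRel (h : IsRotSys σ α) (hplanar : chi2 σ α (univ : Finset D) = 4)
    (hK : numK σ α (univ : Finset D) = 1) (hS : IsClosed α S) (hKS : numK σ α S = 1) (z : D) :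
    ∃ x ∈ S, regRel σ α S z x :=
  (h.regions_main hplanar hK _ S rfl hS hKS).1 z

/-- **Two darts of a connected sub-map lie in the same region iff on the same face** (faces →
regions is one-to-one and well defined). -/
theorem IsRotSys.regRel_iff_sameCycle_phi (h : IsRotSys σ α)
    (hplanar : chi2 σ α (univ : Finset D) = 4) (hK : numK σ α (univ : Finset D) = 1)
    (hS : IsClosed α S) (hKS : numK σ α S = 1) {x y : D} (hx : x ∈ S) (hy : y ∈ S) :
    regRel σ α S x y ↔ (phi σ α S).SameCycle x y :=
  ⟨(h.regions_main hplanar hK _ S rfl hS hKS).2 x hx y hy, regRel_of_sameCycle_phi h hS⟩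

/-- **Every region meets `S`, so the regions are counted on `S`**: the number of `regRel`-classes
on all darts equals the number of `regRel`-classes on `S` (connected sub-map of a planar connected
map). -/
theorem IsRotSys.numClasses_regRel_univ_eq (h : IsRotSys σ α)
    (hplanar : chi2 σ α (univ : Finset D) = 4) (hK : numK σ α (univ : Finset D) = 1)
    (hS : IsClosed α S) (hKS : numK σ α S = 1) :
    numClasses (regRel σ α S) (univ : Finset D) = numClasses (regRel σ α S) S := by
  classical
  unfold numClasses
  have hsy : ∀ (T : Finset D), ∀ x ∈ T, ∀ y ∈ T, regRel σ α S x y → regRel σ α S y x :=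
    fun _ _ _ _ _ hh => regRel_symm hh
  have htr : ∀ (T : Finset D), ∀ x ∈ T, ∀ y ∈ T, ∀ z ∈ T,
      regRel σ α S x y → regRel σ α S y z → regRel σ α S x z :=
    fun _ _ _ _ _ _ _ h1 h2 => regRel_trans h1 h2
  -- the class of `x` (on any `T ∋ x, y`) determines `x` up to the relation
  have hcls : ∀ (T : Finset D), ∀ x ∈ T, ∀ y ∈ T,
      (T.filter fun z => regRel σ α S x z) = (T.filter fun z => regRel σ α S y z) ↔
        regRel σ α S x y := by
    intro T x hx y hy
    constructor
    · intro hxy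
      have : y ∈ T.filter fun z => regRel σ α S x z := by
        rw [hxy]; exact mem_filter.2 ⟨hy, regRel_refl σ α S y⟩
      exact (mem_filter.1 this).2
    · exact filter_eq_filter_of_rel (hsy T) (htr T) hx hy
  -- every region is the region of a dart of `S`
  have himg : ((univ : Finset D).image fun x => (univ : Finset D).filter fun z => regRel σ α S x z)
      = S.image fun x => (univ : Finset D).filter fun z => regRel σ α S x z := by
    apply Subset.antisymm
    · intro A hA
      obtain ⟨z, -, rfl⟩ := mem_image.1 hA
      obtain ⟨x, hx, hzx⟩ := h.exists_mem_regRel hplanar hK hS hKS z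
      exact mem_image.2 ⟨x, hx, ((hcls univ z (mem_univ z) x (mem_univ x)).2 hzx).symm⟩
    · exact image_subset_image (subset_univ S)
  rw [himg]
  exact card_image_eq_of_ker_iff S _ _ fun x hx y hy => by
    rw [hcls univ x (mem_univ x) y (mem_univ y), hcls S x hx y hy]

/-- **The number of regions equals the number of faces** for a connected sub-map of a planar
connected map. -/
theorem IsRotSys.numClasses_regRel_eq_numF (h : IsRotSys σ α)
    (hplanar : chi2 σ α (univ : Finset D) = 4) (hK : numK σ α (univ : Finset D) = 1)
    (hS : IsClosed α S) (hKS : numK σ α S = 1) :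
    numClasses (regRel σ α S) (univ : Finset D) = numF σ α S := by
  rw [h.numClasses_regRel_univ_eq hplanar hK hS hKS]
  unfold numF
  exact numClasses_congr fun x hx y hy => h.regRel_iff_sameCycle_phi hplanar hK hS hKS hx hy

end RotSys

end Summit.Ventures.Crystal3D
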